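import Literature.NumberTheory.Sieve.FriedlanderIwaniecPrimesJacobiTwistedFlipReduction
import Literature.NumberTheory.Sieve.FriedlanderIwaniecPrimesJacobiTwistedModulusRange
import Literature.NumberTheory.Sieve.FriedlanderIwaniecPrimesJacobiTwistedKernelInsertion
import Literature.NumberTheory.Sieve.FriedlanderIwaniecPrimesJacobiTwistedDyadicModuli
import HarnessLib

/-!
# Friedlander–Iwaniec, *The polynomial `X² + Y⁴` captures its primes*, §12: the bound for `V_{cm}(f,g)`

[FI, §12, p. 51 of arXiv:math/9811185 = Ann. of Math. (2) 148 (1998), 945–1040]: after (12.9) the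
authors reduce by `c = (r₁,r₂)` and Möbius in `m ∣ c` to the forms `V_{cm}(f,g)`, flip the modulus
((12.10)–(12.12)), separate variables by the Fourier/Mellin kernels ((12.13)–(12.16)) and conclude:
"At last we are ready to apply Proposition 11.1*.  This gives, by (12.12), (12.15) and (12.16),
`V_{cm}(f,g) ≪ {(cm)^{-1/2}(DHRS)^{1/2}(log 2RS)³ + [c^{-3/2} m D⁻¹(RS)^{3/2} + RS^{3/4} + SR^{3/4}](RS)^ε}
 ∑∑_{(r,s)=1} τ(r)|α_{crs}|²`."

This file PROVES that bound (`exists_norm_flipForm_le`) by composing the kernel theorems of the four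
steps: the flip `sum_dvd_mul_eq_sum_complementary`, the range bookkeeping `sum_moduli_eq_sum_range`,
the kernel insertion `norm_sum_mul_kernel_le`, and Proposition 11.1* over the range
`exists_prop111Star_mixed_range`.  The bound is stated with the cutoff parameters `a, b` of `g`
(FI: `a = S/(HR)`, `b = S/R`), the kernel costs `K L²` of `g` and `∫(1+|t|)²|M|` of `f`, and the
norms `∑∑|α_{c t, s}|²`, `∑∑ τ(t)|α_{c t, s}|²` over the reduced box; the choice `H = (RS/D)^{1/3}` and
the summation over `c, m` are left to the assembly of Proposition 12.1.  No definitions, no named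
facts (HOME/parity-ideate-lit/FI98-Prop121-MAP.md, step D-f of the g26 addendum).

## References

* J. Friedlander, H. Iwaniec, *The polynomial `X² + Y⁴` captures its primes*, Ann. of Math. (2) 148
  (1998), 945–1040, §12, (12.10)–(12.17). [FriedlanderIwaniecAnnals1998]
-/

noncomputable section

open Finset Real Complex MeasureTheory
open scoped NumberTheorySymbols ArithmeticFunction.sigma ComplexConjugate

namespace Literature.NumberTheory.Sieve.FriedlanderIwaniecPrimes

/-- `|e(x)| = 1`. [folklore] -/
private theorem norm_cexp_two_pi_I (x : ℝ) : ‖Complex.exp (2 * π * I * x)‖ = 1 := by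
  rw [show (2 * π * I * x : ℂ) = ((2 * π * x : ℝ) : ℂ) * I by push_cast; ring,
    Complex.norm_exp_ofReal_mul_I]

/-- **The bound for `V_{cm}(f,g)`** [FI, §12, display after (12.16)]: for every `0 < ε ≤ 1` there is
`C > 0` such that for `R, S, D ≥ 1`, `1 ≤ c ≤ R` odd, `m ≥ 1`, `N ≥ 4RS`, coefficients `α` supported on
`(r, 2s) = 1` in one class modulo `4`, a weight `F` vanishing off `(1/2, 5/2)` with Mellin-type kernel
`M` (`F(w) = ∫ M(t) w^{2πit} dt`), and a cutoff `g` (`g(0) = 0`, `g = 0` off `(a, 3b)`, `a > 0`) whose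
twisted transforms have `L¹` norms `≤ K(1+|t|)²L²`,
`|∑_{d ≤ N} F(dm/D) ∑∑_{dm ∣ Δ, (t₁,t₂)=1} (dm/(t₁t₂)) α_{ct₁s₁} ᾱ_{ct₂s₂} g(|s₁/(ct₁) − s₂/(ct₂)|)|
  ≤ C (1 + log Q₂) {(XS/√(mQ₁)·log 2R + XS) N + (mQ₂√(XS) + XS^{3/4} + SX^{3/4})(XS)^ε T} · K L² ∫(1+|t|)²|M|`,
where `X = R/c`, `Q₁ = 2aR²/(5cD)`, `Q₂ = max(1, 24bR²/(cD))`, `N = ∑∑|α_{ct,s}|²`, `T = ∑∑τ(t)|α_{ct,s}|²`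
over `R/c < t ≤ 2R/c`, `S < s ≤ 2S` (the `g`-factor is set to `0` on the excluded diagonal `Δ = 0`,
where `g(0) = 0` anyway). [cite: FriedlanderIwaniecAnnals1998, §12, (12.10)–(12.17)] -/
theorem exists_norm_flipForm_le {ε : ℝ} (hε : 0 < ε) (hε1 : ε ≤ 1) :
    ∃ C : ℝ, 0 < C ∧ ∀ (R S D c m N : ℕ) (α : ℕ → ℕ → ℂ) (F : ℝ → ℝ) (M : ℝ → ℂ) (g : ℝ → ℝ)
      (a b K L : ℝ),
      1 ≤ R → 1 ≤ S → 1 ≤ D → 1 ≤ c → c ≤ R → Odd c → 0 < m → 4 * R * S ≤ N →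
      (∀ r s, α r s ≠ 0 → r.Coprime (2 * s)) →
      (∀ r₁ s₁ r₂ s₂, α r₁ s₁ ≠ 0 → α r₂ s₂ ≠ 0 → r₁ % 4 = r₂ % 4) →
      Continuous M → (∀ k : ℕ, Integrable (fun t : ℝ => |t| ^ k * ‖M t‖)) →
      (∀ w : ℝ, 0 < w → (F w : ℂ) = ∫ t : ℝ, M t * Complex.exp (2 * π * I * t * Real.log w)) →
      (∀ w, w ≤ 1 / 2 → F w = 0) → (∀ w, 5 / 2 ≤ w → F w = 0) →
      g 0 = 0 → 0 < a → (∀ x, x ≤ a → g x = 0) → (∀ x, 3 * b ≤ x → g x = 0) →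
      (∀ t : ℝ, ∃ Ĝ : ℝ → ℂ, Integrable Ĝ ∧ (∫ u, ‖Ĝ u‖) ≤ K * (1 + |t|) ^ 2 * L ^ 2 ∧
        ∀ x : ℝ, ((g |x| : ℝ) : ℂ) * Complex.exp (2 * π * I * t * (Real.log |x| : ℝ)) =
          ∫ u, Ĝ u * Complex.exp (2 * π * I * u * x)) →
      ‖∑ d ∈ Ioc 0 N, (F (((d * m : ℕ) : ℝ) / D) : ℂ) *
          ∑ t₁ ∈ Ioc (R / c) (2 * R / c), ∑ s₁ ∈ Ioc S (2 * S), ∑ t₂ ∈ Ioc (R / c) (2 * R / c),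
            ∑ s₂ ∈ Ioc S (2 * S),
            (if ((d * m : ℕ) : ℤ) ∣ (t₁ : ℤ) * s₂ - (t₂ : ℤ) * s₁ ∧ t₁.Coprime t₂ then
              (J(((d * m : ℕ) : ℤ) | t₁ * t₂) : ℂ) *
                (α (c * t₁) s₁ * conj (α (c * t₂) s₂) *
                  (if (t₁ : ℤ) * s₂ - (t₂ : ℤ) * s₁ = 0 then (0 : ℂ) else
                    (g |(s₁ : ℝ) / (c * t₁) - (s₂ : ℝ) / (c * t₂)| : ℂ))) else 0)‖ ≤
        C * (1 + Real.log (max 1 (24 * b * (R : ℝ) ^ 2 / (c * D)))) *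
          (((R : ℝ) / c * S / Real.sqrt ((m : ℝ) * (2 * a * (R : ℝ) ^ 2 / (5 * c * D))) *
                Real.log (2 * R) + (R : ℝ) / c * S) *
              (∑ t ∈ Ioc (R / c) (2 * R / c), ∑ s ∈ Ioc S (2 * S), ‖α (c * t) s‖ ^ 2) +
            ((m : ℝ) * (max 1 (24 * b * (R : ℝ) ^ 2 / (c * D))) * Real.sqrt ((R : ℝ) / c * S) +
                (R : ℝ) / c * (S : ℝ) ^ (3 / 4 : ℝ) + (S : ℝ) * ((R : ℝ) / c) ^ (3 / 4 : ℝ)) *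
              ((R : ℝ) / c * S) ^ ε *
              (∑ t ∈ Ioc (R / c) (2 * R / c), ∑ s ∈ Ioc S (2 * S),
                (σ 0 t : ℝ) * ‖α (c * t) s‖ ^ 2)) *
          (K * L ^ 2 * ∫ t : ℝ, (1 + |t|) ^ 2 * ‖M t‖) := by
  obtain ⟨C, hC, hdy⟩ := exists_prop111Star_mixed_range hε hε1
  refine ⟨C, hC, ?_⟩
  intro R S D c m N α F M g a b K L hR hS hD hc1 hcR hcodd hm hN hα hα4 hMc hMi hFM hF3 hF4 hg00 ha
    hga hgb hĜ
  have hc : 0 < c := hc1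
  have hD0 : 0 < D := hD
  set IT := Ioc (R / c) (2 * R / c) with hIT
  set IS := Ioc S (2 * S) with hIS
  set Q₁ : ℝ := 2 * a * (R : ℝ) ^ 2 / (5 * c * D) with hQ₁
  set Q₂ : ℝ := max 1 (24 * b * (R : ℝ) ^ 2 / (c * D)) with hQ₂
  set 𝒬 : Finset ℕ := (Ioc 0 N).filter (fun q : ℕ =>
      2 * a * (R : ℝ) ^ 2 / (5 * c * D) < q ∧ (q : ℝ) < 24 * b * (R : ℝ) ^ 2 / (c * D)) with h𝒬
  set Nn : ℝ := ∑ t ∈ IT, ∑ s ∈ IS, ‖α (c * t) s‖ ^ 2 with hNn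
  set Tn : ℝ := ∑ t ∈ IT, ∑ s ∈ IS, (σ 0 t : ℝ) * ‖α (c * t) s‖ ^ 2 with hTn
  -- Step 1: the flip (12.10)–(12.11)
  have h1 : ∑ d ∈ Ioc 0 N, (F (((d * m : ℕ) : ℝ) / D) : ℂ) *
      ∑ t₁ ∈ IT, ∑ s₁ ∈ IS, ∑ t₂ ∈ IT, ∑ s₂ ∈ IS,
        (if ((d * m : ℕ) : ℤ) ∣ (t₁ : ℤ) * s₂ - (t₂ : ℤ) * s₁ ∧ t₁.Coprime t₂ then
          (J(((d * m : ℕ) : ℤ) | t₁ * t₂) : ℂ) *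
            (α (c * t₁) s₁ * conj (α (c * t₂) s₂) *
              (if (t₁ : ℤ) * s₂ - (t₂ : ℤ) * s₁ = 0 then (0 : ℂ) else
                (g |(s₁ : ℝ) / (c * t₁) - (s₂ : ℝ) / (c * t₂)| : ℂ))) else 0) =
      ∑ q ∈ Ioc 0 N, ∑ t₁ ∈ IT, ∑ s₁ ∈ IS, ∑ t₂ ∈ IT, ∑ s₂ ∈ IS,
        (if ((q * m : ℕ) : ℤ) ∣ (t₁ : ℤ) * s₂ - (t₂ : ℤ) * s₁ ∧ t₁.Coprime t₂ then
          (if t₁.Coprime m then (J((s₁ : ℤ) | t₁) : ℂ) * α (c * t₁) s₁ else 0) *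
            conj (if t₂.Coprime m then (J((s₂ : ℤ) | t₂) : ℂ) * α (c * t₂) s₂ else 0) *
            (J((q : ℤ) | t₁ * t₂) : ℂ) *
            ((F (((((t₁ : ℤ) * s₂ - (t₂ : ℤ) * s₁).natAbs / q : ℕ) : ℝ) / D) : ℂ) *
              (if (t₁ : ℤ) * s₂ - (t₂ : ℤ) * s₁ = 0 then (0 : ℂ) else
                (g |(s₁ : ℝ) / (c * t₁) - (s₂ : ℝ) / (c * t₂)| : ℂ))) else 0) :=
    sum_dvd_mul_eq_sum_complementary hcodd hm hN (fun d : ℕ => (F ((d : ℝ) / D) : ℂ)) α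
      (fun t₁ s₁ t₂ s₂ => if (t₁ : ℤ) * s₂ - (t₂ : ℤ) * s₁ = 0 then (0 : ℂ) else
        (g |(s₁ : ℝ) / (c * t₁) - (s₂ : ℝ) / (c * t₂)| : ℂ)) hα hα4
      (fun t₁ s₁ t₂ s₂ h => by simp only [h, if_true])
  -- Step 2: on the (excluded) diagonal `Δ = 0` the weight `F(0) = 0` kills the term anyway
  have hF00 : F 0 = 0 := hF3 0 (by norm_num)
  have h2 : ∑ q ∈ Ioc 0 N, ∑ t₁ ∈ IT, ∑ s₁ ∈ IS, ∑ t₂ ∈ IT, ∑ s₂ ∈ IS,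
        (if ((q * m : ℕ) : ℤ) ∣ (t₁ : ℤ) * s₂ - (t₂ : ℤ) * s₁ ∧ t₁.Coprime t₂ then
          (if t₁.Coprime m then (J((s₁ : ℤ) | t₁) : ℂ) * α (c * t₁) s₁ else 0) *
            conj (if t₂.Coprime m then (J((s₂ : ℤ) | t₂) : ℂ) * α (c * t₂) s₂ else 0) *
            (J((q : ℤ) | t₁ * t₂) : ℂ) *
            ((F (((((t₁ : ℤ) * s₂ - (t₂ : ℤ) * s₁).natAbs / q : ℕ) : ℝ) / D) : ℂ) *
              (if (t₁ : ℤ) * s₂ - (t₂ : ℤ) * s₁ = 0 then (0 : ℂ) else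
                (g |(s₁ : ℝ) / (c * t₁) - (s₂ : ℝ) / (c * t₂)| : ℂ))) else 0) =
      ∑ q ∈ Ioc 0 N, ∑ t₁ ∈ IT, ∑ s₁ ∈ IS, ∑ t₂ ∈ IT, ∑ s₂ ∈ IS,
        (if ((q * m : ℕ) : ℤ) ∣ (t₁ : ℤ) * s₂ - (t₂ : ℤ) * s₁ ∧ t₁.Coprime t₂ then
          (if t₁.Coprime m then (J((s₁ : ℤ) | t₁) : ℂ) * α (c * t₁) s₁ else 0) *
            conj (if t₂.Coprime m then (J((s₂ : ℤ) | t₂) : ℂ) * α (c * t₂) s₂ else 0) *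
            (J((q : ℤ) | t₁ * t₂) : ℂ) *
            ((F (((((t₁ : ℤ) * s₂ - (t₂ : ℤ) * s₁).natAbs / q : ℕ) : ℝ) / D) : ℂ) *
              (g |(s₁ : ℝ) / (c * t₁) - (s₂ : ℝ) / (c * t₂)| : ℂ)) else 0) := by
    refine sum_congr rfl fun q _ => sum_congr rfl fun t₁ _ => sum_congr rfl fun s₁ _ =>
      sum_congr rfl fun t₂ _ => sum_congr rfl fun s₂ _ => ?_
    by_cases hΔ : (t₁ : ℤ) * s₂ - (t₂ : ℤ) * s₁ = 0
    · simp [hΔ, hF00]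
    · simp only [hΔ, if_false]
  -- Step 3: the range (12.12) and the kernel weight
  have h3 := sum_moduli_eq_sum_range (S := S) (m := m) (L := N) hR hc hD0 F hF3 hF4 g ha hga hgb
    (fun t s : ℕ => if t.Coprime m then (J((s : ℤ) | t) : ℂ) * α (c * t) s else 0)
  -- Step 4: the kernel insertion, fed by Proposition 11.1* over the range
  have hQ₁pos : 0 < Q₁ := by rw [hQ₁]; positivity
  have hQ₂1 : 1 ≤ Q₂ := le_max_left _ _
  have h𝒬pos : ∀ q ∈ 𝒬, 0 < q := fun q hq => (mem_Ioc.mp (mem_filter.mp hq).1).1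
  have h𝒬range : ∀ q ∈ 𝒬, 1 ≤ q ∧ Q₁ < (q : ℝ) ∧ (q : ℝ) ≤ Q₂ := by
    intro q hq
    obtain ⟨hq1, hq2, hq3⟩ := mem_filter.mp hq
    exact ⟨(mem_Ioc.mp hq1).1, hq2, hq3.le.trans (le_max_right _ _)⟩
  have hITpos : ∀ r ∈ IT, 0 < r := fun r hr => lt_of_le_of_lt (Nat.zero_le _) (mem_Ioc.mp hr).1
  have hS0 : (0 : ℝ) ≤ S := Nat.cast_nonneg S
  have hX0 : 0 ≤ (R : ℝ) / c := by positivity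
  have hNn0 : 0 ≤ Nn := sum_nonneg fun _ _ => sum_nonneg fun _ _ => sq_nonneg _
  have hTn0 : 0 ≤ Tn :=
    sum_nonneg fun _ _ => sum_nonneg fun _ _ => mul_nonneg (Nat.cast_nonneg _) (sq_nonneg _)
  have hlogQ₂ : 0 ≤ Real.log Q₂ := Real.log_nonneg hQ₂1
  have hlogR : 0 ≤ Real.log (2 * R) := Real.log_nonneg (by
    have : (1 : ℝ) ≤ R := by exact_mod_cast hR
    linarith)
  -- the coefficient vector after the flip and its pointwise domination by `|α_{ct,s}|`
  have hβle : ∀ t s : ℕ, ‖(if t.Coprime m then (J((s : ℤ) | t) : ℂ) * α (c * t) s else 0)‖ ≤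
      ‖α (c * t) s‖ := by
    intro t s
    split_ifs
    · rw [norm_mul]
      have hJ : ‖(J((s : ℤ) | t) : ℂ)‖ ≤ 1 := by
        rcases jacobiSym.trichotomy (s : ℤ) t with h | h | h <;> simp [h]
      calc ‖(J((s : ℤ) | t) : ℂ)‖ * ‖α (c * t) s‖ ≤ 1 * ‖α (c * t) s‖ :=
          mul_le_mul_of_nonneg_right hJ (norm_nonneg _)
        _ = ‖α (c * t) s‖ := one_mul _
    · rw [norm_zero]; exact norm_nonneg _
  have hβsupp : ∀ t s : ℕ, (if t.Coprime m then (J((s : ℤ) | t) : ℂ) * α (c * t) s else 0) ≠ 0 →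
      Odd t ∧ t.Coprime m := by
    intro t s h
    by_cases htm : t.Coprime m
    · rw [if_pos htm] at h
      have hα0 : α (c * t) s ≠ 0 := fun h0 => h (by rw [h0, mul_zero])
      have hcop := hα (c * t) s hα0
      have h2 : (c * t).Coprime 2 := Nat.Coprime.coprime_dvd_right (dvd_mul_right 2 s) hcop
      have hodd : Odd (c * t) := Nat.coprime_two_right.mp h2
      exact ⟨(Nat.odd_mul.mp hodd).2, htm⟩
    · exact absurd (by rw [if_neg htm]) h
  set B : ℝ := C * (1 + Real.log Q₂) *
      (((R : ℝ) / c * S / Real.sqrt ((m : ℝ) * Q₁) * Real.log (2 * R) + (R : ℝ) / c * S) * Nn +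
        ((m : ℝ) * Q₂ * Real.sqrt ((R : ℝ) / c * S) + (R : ℝ) / c * (S : ℝ) ^ (3 / 4 : ℝ) +
            (S : ℝ) * ((R : ℝ) / c) ^ (3 / 4 : ℝ)) * ((R : ℝ) / c * S) ^ ε * Tn) with hB
  have hBound : ∀ u t : ℝ, ∑ q ∈ 𝒬, ‖∑ t₁ ∈ IT, ∑ s₁ ∈ IS, ∑ t₂ ∈ IT, ∑ s₂ ∈ IS,
      (if ((q * m : ℕ) : ℤ) ∣ (t₁ : ℤ) * s₂ - (t₂ : ℤ) * s₁ ∧ t₁.Coprime t₂ then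
        ((if t₁.Coprime m then (J((s₁ : ℤ) | t₁) : ℂ) * α (c * t₁) s₁ else 0) *
              Complex.exp (2 * π * I * t * Real.log t₁) *
            Complex.exp (2 * π * I * u * ((s₁ : ℝ) / (c * t₁) : ℝ))) *
          conj ((if t₂.Coprime m then (J((s₂ : ℤ) | t₂) : ℂ) * α (c * t₂) s₂ else 0) *
              Complex.exp (-(2 * π * I * t * Real.log t₂)) *
            Complex.exp (2 * π * I * u * ((s₂ : ℝ) / (c * t₂) : ℝ))) *
          (J((q : ℤ) | t₁ * t₂) : ℂ) else 0)‖ ≤ B := by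
    intro u t
    have hd := hdy m R S c 𝒬 Q₁ Q₂
      (fun t₁ s₁ : ℕ => (if t₁.Coprime m then (J((s₁ : ℤ) | t₁) : ℂ) * α (c * t₁) s₁ else 0) *
          Complex.exp (2 * π * I * t * Real.log t₁) *
        Complex.exp (2 * π * I * u * ((s₁ : ℝ) / (c * t₁) : ℝ)))
      (fun t₂ s₂ : ℕ => (if t₂.Coprime m then (J((s₂ : ℤ) | t₂) : ℂ) * α (c * t₂) s₂ else 0) *
          Complex.exp (-(2 * π * I * t * Real.log t₂)) *
        Complex.exp (2 * π * I * u * ((s₂ : ℝ) / (c * t₂) : ℝ)))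
      hm hS hc1 hcR hQ₁pos hQ₂1 h𝒬range
      (fun t₁ s₁ h => hβsupp t₁ s₁ (mul_ne_zero_iff.mp (mul_ne_zero_iff.mp h).1).1)
      (fun t₂ s₂ h => hβsupp t₂ s₂ (mul_ne_zero_iff.mp (mul_ne_zero_iff.mp h).1).1)
    refine hd.trans ?_
    -- the twisted vectors have the norms of `β`, dominated by `|α_{ct,s}|`
    have hn1 : ∀ t₁ s₁ : ℕ, ‖(if t₁.Coprime m then (J((s₁ : ℤ) | t₁) : ℂ) * α (c * t₁) s₁ else 0) *
          Complex.exp (2 * π * I * t * Real.log t₁) *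
        Complex.exp (2 * π * I * u * ((s₁ : ℝ) / (c * t₁) : ℝ))‖ ≤ ‖α (c * t₁) s₁‖ := by
      intro t₁ s₁
      rw [norm_mul, norm_mul, show (2 * π * I * t * Real.log t₁ : ℂ) =
        2 * π * I * ((t * Real.log t₁ : ℝ) : ℂ) by push_cast; ring, norm_cexp_two_pi_I,
        show (2 * π * I * u * ((s₁ : ℝ) / (c * t₁) : ℝ) : ℂ) =
          2 * π * I * ((u * ((s₁ : ℝ) / (c * t₁)) : ℝ) : ℂ) by push_cast; ring, norm_cexp_two_pi_I,
        mul_one, mul_one]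
      exact hβle t₁ s₁
    have hn2 : ∀ t₂ s₂ : ℕ, ‖(if t₂.Coprime m then (J((s₂ : ℤ) | t₂) : ℂ) * α (c * t₂) s₂ else 0) *
          Complex.exp (-(2 * π * I * t * Real.log t₂)) *
        Complex.exp (2 * π * I * u * ((s₂ : ℝ) / (c * t₂) : ℝ))‖ ≤ ‖α (c * t₂) s₂‖ := by
      intro t₂ s₂
      rw [norm_mul, norm_mul, show (-(2 * π * I * t * Real.log t₂) : ℂ) =
        2 * π * I * ((-(t * Real.log t₂) : ℝ) : ℂ) by push_cast; ring, norm_cexp_two_pi_I,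
        show (2 * π * I * u * ((s₂ : ℝ) / (c * t₂) : ℝ) : ℂ) =
          2 * π * I * ((u * ((s₂ : ℝ) / (c * t₂)) : ℝ) : ℂ) by push_cast; ring, norm_cexp_two_pi_I,
        mul_one, mul_one]
      exact hβle t₂ s₂
    -- hence the four square-root factors are at most `√Nn, √Nn, √Tn, √Tn`
    have hsqN : ∀ γ : ℕ → ℕ → ℂ, (∀ t₁ s₁ : ℕ, ‖γ t₁ s₁‖ ≤ ‖α (c * t₁) s₁‖) →
        Real.sqrt (∑ r ∈ IT, ∑ s ∈ IS, ‖γ r s‖ ^ 2) ≤ Real.sqrt Nn := by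
      intro γ hγ
      refine Real.sqrt_le_sqrt (sum_le_sum fun r _ => sum_le_sum fun s _ => ?_)
      exact pow_le_pow_left₀ (norm_nonneg _) (hγ r s) 2
    have hsqT : ∀ γ : ℕ → ℕ → ℂ, (∀ t₁ s₁ : ℕ, ‖γ t₁ s₁‖ ≤ ‖α (c * t₁) s₁‖) →
        Real.sqrt (∑ r ∈ IT, ∑ s ∈ IS, (σ 0 r : ℝ) * ‖γ r s‖ ^ 2) ≤ Real.sqrt Tn := by
      intro γ hγ
      refine Real.sqrt_le_sqrt (sum_le_sum fun r _ => sum_le_sum fun s _ => ?_)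
      exact mul_le_mul_of_nonneg_left (pow_le_pow_left₀ (norm_nonneg _) (hγ r s) 2)
        (Nat.cast_nonneg _)
    have hNN : Real.sqrt Nn * Real.sqrt Nn = Nn := Real.mul_self_sqrt hNn0
    have hTT : Real.sqrt Tn * Real.sqrt Tn = Tn := Real.mul_self_sqrt hTn0
    have hP1 : 0 ≤ (R : ℝ) / c * S / Real.sqrt ((m : ℝ) * Q₁) * Real.log (2 * R) + (R : ℝ) / c * S :=
      add_nonneg (mul_nonneg (div_nonneg (mul_nonneg hX0 hS0) (Real.sqrt_nonneg _)) hlogR)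
        (mul_nonneg hX0 hS0)
    have hm0 : (0 : ℝ) ≤ m := Nat.cast_nonneg m
    have hP2 : 0 ≤ ((m : ℝ) * Q₂ * Real.sqrt ((R : ℝ) / c * S) + (R : ℝ) / c * (S : ℝ) ^ (3 / 4 : ℝ) +
        (S : ℝ) * ((R : ℝ) / c) ^ (3 / 4 : ℝ)) * ((R : ℝ) / c * S) ^ ε :=
      mul_nonneg (add_nonneg (add_nonneg (mul_nonneg (mul_nonneg hm0 (by linarith))
        (Real.sqrt_nonneg _)) (mul_nonneg hX0 (Real.rpow_nonneg hS0 _)))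
        (mul_nonneg hS0 (Real.rpow_nonneg hX0 _))) (Real.rpow_nonneg (mul_nonneg hX0 hS0) _)
    rw [hB]
    refine mul_le_mul_of_nonneg_left (add_le_add ?_ ?_) (mul_nonneg hC.le (by linarith))
    · refine mul_le_mul_of_nonneg_left ?_ hP1
      rw [← hNN]
      exact mul_le_mul (hsqN _ hn1) (hsqN _ hn2) (Real.sqrt_nonneg _) (Real.sqrt_nonneg _)
    · refine mul_le_mul_of_nonneg_left ?_ hP2
      rw [← hTT]
      exact mul_le_mul (hsqT _ hn1) (hsqT _ hn2) (Real.sqrt_nonneg _) (Real.sqrt_nonneg _)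
  have hKI := norm_sum_mul_kernel_le hc hD0 hMc hMi hFM hg00 hĜ 𝒬 IT IS h𝒬pos hITpos
    (fun t s : ℕ => if t.Coprime m then (J((s : ℤ) | t) : ℂ) * α (c * t) s else 0)
    (fun q t₁ s₁ t₂ s₂ : ℕ => ((q * m : ℕ) : ℤ) ∣ (t₁ : ℤ) * s₂ - (t₂ : ℤ) * s₁ ∧ t₁.Coprime t₂) hBound
  -- Step 5: collect
  rw [h1, h2, h3]
  exact hKI

/-- **The bound for `V_{cm}(f,g)`, sharp `q = 1` term** [FI, §12, display after (12.16)]: as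
`exists_norm_flipForm_le` with the block-free modulus charged `XS/√Q₁` (via
`exists_prop111Star_mixed_range'`): for every `0 < ε ≤ 1` there is
`C > 0` such that for `R, S, D ≥ 1`, `1 ≤ c ≤ R` odd, `m ≥ 1`, `N ≥ 4RS`, coefficients `α` supported on
`(r, 2s) = 1` in one class modulo `4`, a weight `F` vanishing off `(1/2, 5/2)` with Mellin-type kernel
`M` (`F(w) = ∫ M(t) w^{2πit} dt`), and a cutoff `g` (`g(0) = 0`, `g = 0` off `(a, 3b)`, `a > 0`) whose
twisted transforms have `L¹` norms `≤ K(1+|t|)²L²`,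
`|∑_{d ≤ N} F(dm/D) ∑∑_{dm ∣ Δ, (t₁,t₂)=1} (dm/(t₁t₂)) α_{ct₁s₁} ᾱ_{ct₂s₂} g(|s₁/(ct₁) − s₂/(ct₂)|)|
  ≤ C (1 + log Q₂) {(XS/√(mQ₁)·log 2R + XS/√Q₁) N + (mQ₂√(XS) + XS^{3/4} + SX^{3/4})(XS)^ε T} · K L² ∫(1+|t|)²|M|`,
where `X = R/c`, `Q₁ = 2aR²/(5cD)`, `Q₂ = max(1, 24bR²/(cD))`, `N = ∑∑|α_{ct,s}|²`, `T = ∑∑τ(t)|α_{ct,s}|²`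
over `R/c < t ≤ 2R/c`, `S < s ≤ 2S` (the `g`-factor is set to `0` on the excluded diagonal `Δ = 0`,
where `g(0) = 0` anyway). [cite: FriedlanderIwaniecAnnals1998, §12, (12.10)–(12.17)] -/
theorem exists_norm_flipForm_le' {ε : ℝ} (hε : 0 < ε) (hε1 : ε ≤ 1) :
    ∃ C : ℝ, 0 < C ∧ ∀ (R S D c m N : ℕ) (α : ℕ → ℕ → ℂ) (F : ℝ → ℝ) (M : ℝ → ℂ) (g : ℝ → ℝ)
      (a b K L : ℝ),
      1 ≤ R → 1 ≤ S → 1 ≤ D → 1 ≤ c → c ≤ R → Odd c → 0 < m → 4 * R * S ≤ N →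
      (∀ r s, α r s ≠ 0 → r.Coprime (2 * s)) →
      (∀ r₁ s₁ r₂ s₂, α r₁ s₁ ≠ 0 → α r₂ s₂ ≠ 0 → r₁ % 4 = r₂ % 4) →
      Continuous M → (∀ k : ℕ, Integrable (fun t : ℝ => |t| ^ k * ‖M t‖)) →
      (∀ w : ℝ, 0 < w → (F w : ℂ) = ∫ t : ℝ, M t * Complex.exp (2 * π * I * t * Real.log w)) →
      (∀ w, w ≤ 1 / 2 → F w = 0) → (∀ w, 5 / 2 ≤ w → F w = 0) →
      g 0 = 0 → 0 < a → (∀ x, x ≤ a → g x = 0) → (∀ x, 3 * b ≤ x → g x = 0) →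
      (∀ t : ℝ, ∃ Ĝ : ℝ → ℂ, Integrable Ĝ ∧ (∫ u, ‖Ĝ u‖) ≤ K * (1 + |t|) ^ 2 * L ^ 2 ∧
        ∀ x : ℝ, ((g |x| : ℝ) : ℂ) * Complex.exp (2 * π * I * t * (Real.log |x| : ℝ)) =
          ∫ u, Ĝ u * Complex.exp (2 * π * I * u * x)) →
      ‖∑ d ∈ Ioc 0 N, (F (((d * m : ℕ) : ℝ) / D) : ℂ) *
          ∑ t₁ ∈ Ioc (R / c) (2 * R / c), ∑ s₁ ∈ Ioc S (2 * S), ∑ t₂ ∈ Ioc (R / c) (2 * R / c),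
            ∑ s₂ ∈ Ioc S (2 * S),
            (if ((d * m : ℕ) : ℤ) ∣ (t₁ : ℤ) * s₂ - (t₂ : ℤ) * s₁ ∧ t₁.Coprime t₂ then
              (J(((d * m : ℕ) : ℤ) | t₁ * t₂) : ℂ) *
                (α (c * t₁) s₁ * conj (α (c * t₂) s₂) *
                  (if (t₁ : ℤ) * s₂ - (t₂ : ℤ) * s₁ = 0 then (0 : ℂ) else
                    (g |(s₁ : ℝ) / (c * t₁) - (s₂ : ℝ) / (c * t₂)| : ℂ))) else 0)‖ ≤
        C * (1 + Real.log (max 1 (24 * b * (R : ℝ) ^ 2 / (c * D)))) *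
          (((R : ℝ) / c * S / Real.sqrt ((m : ℝ) * (2 * a * (R : ℝ) ^ 2 / (5 * c * D))) *
                Real.log (2 * R) + (R : ℝ) / c * S / Real.sqrt (2 * a * (R : ℝ) ^ 2 / (5 * c * D))) *
              (∑ t ∈ Ioc (R / c) (2 * R / c), ∑ s ∈ Ioc S (2 * S), ‖α (c * t) s‖ ^ 2) +
            ((m : ℝ) * (max 1 (24 * b * (R : ℝ) ^ 2 / (c * D))) * Real.sqrt ((R : ℝ) / c * S) +
                (R : ℝ) / c * (S : ℝ) ^ (3 / 4 : ℝ) + (S : ℝ) * ((R : ℝ) / c) ^ (3 / 4 : ℝ)) *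
              ((R : ℝ) / c * S) ^ ε *
              (∑ t ∈ Ioc (R / c) (2 * R / c), ∑ s ∈ Ioc S (2 * S),
                (σ 0 t : ℝ) * ‖α (c * t) s‖ ^ 2)) *
          (K * L ^ 2 * ∫ t : ℝ, (1 + |t|) ^ 2 * ‖M t‖) := by
  obtain ⟨C, hC, hdy⟩ := exists_prop111Star_mixed_range' hε hε1
  refine ⟨C, hC, ?_⟩
  intro R S D c m N α F M g a b K L hR hS hD hc1 hcR hcodd hm hN hα hα4 hMc hMi hFM hF3 hF4 hg00 ha
    hga hgb hĜ
  have hc : 0 < c := hc1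
  have hD0 : 0 < D := hD
  set IT := Ioc (R / c) (2 * R / c) with hIT
  set IS := Ioc S (2 * S) with hIS
  set Q₁ : ℝ := 2 * a * (R : ℝ) ^ 2 / (5 * c * D) with hQ₁
  set Q₂ : ℝ := max 1 (24 * b * (R : ℝ) ^ 2 / (c * D)) with hQ₂
  set 𝒬 : Finset ℕ := (Ioc 0 N).filter (fun q : ℕ =>
      2 * a * (R : ℝ) ^ 2 / (5 * c * D) < q ∧ (q : ℝ) < 24 * b * (R : ℝ) ^ 2 / (c * D)) with h𝒬
  set Nn : ℝ := ∑ t ∈ IT, ∑ s ∈ IS, ‖α (c * t) s‖ ^ 2 with hNn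
  set Tn : ℝ := ∑ t ∈ IT, ∑ s ∈ IS, (σ 0 t : ℝ) * ‖α (c * t) s‖ ^ 2 with hTn
  -- Step 1: the flip (12.10)–(12.11)
  have h1 : ∑ d ∈ Ioc 0 N, (F (((d * m : ℕ) : ℝ) / D) : ℂ) *
      ∑ t₁ ∈ IT, ∑ s₁ ∈ IS, ∑ t₂ ∈ IT, ∑ s₂ ∈ IS,
        (if ((d * m : ℕ) : ℤ) ∣ (t₁ : ℤ) * s₂ - (t₂ : ℤ) * s₁ ∧ t₁.Coprime t₂ then
          (J(((d * m : ℕ) : ℤ) | t₁ * t₂) : ℂ) *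
            (α (c * t₁) s₁ * conj (α (c * t₂) s₂) *
              (if (t₁ : ℤ) * s₂ - (t₂ : ℤ) * s₁ = 0 then (0 : ℂ) else
                (g |(s₁ : ℝ) / (c * t₁) - (s₂ : ℝ) / (c * t₂)| : ℂ))) else 0) =
      ∑ q ∈ Ioc 0 N, ∑ t₁ ∈ IT, ∑ s₁ ∈ IS, ∑ t₂ ∈ IT, ∑ s₂ ∈ IS,
        (if ((q * m : ℕ) : ℤ) ∣ (t₁ : ℤ) * s₂ - (t₂ : ℤ) * s₁ ∧ t₁.Coprime t₂ then
          (if t₁.Coprime m then (J((s₁ : ℤ) | t₁) : ℂ) * α (c * t₁) s₁ else 0) *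
            conj (if t₂.Coprime m then (J((s₂ : ℤ) | t₂) : ℂ) * α (c * t₂) s₂ else 0) *
            (J((q : ℤ) | t₁ * t₂) : ℂ) *
            ((F (((((t₁ : ℤ) * s₂ - (t₂ : ℤ) * s₁).natAbs / q : ℕ) : ℝ) / D) : ℂ) *
              (if (t₁ : ℤ) * s₂ - (t₂ : ℤ) * s₁ = 0 then (0 : ℂ) else
                (g |(s₁ : ℝ) / (c * t₁) - (s₂ : ℝ) / (c * t₂)| : ℂ))) else 0) :=
    sum_dvd_mul_eq_sum_complementary hcodd hm hN (fun d : ℕ => (F ((d : ℝ) / D) : ℂ)) α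
      (fun t₁ s₁ t₂ s₂ => if (t₁ : ℤ) * s₂ - (t₂ : ℤ) * s₁ = 0 then (0 : ℂ) else
        (g |(s₁ : ℝ) / (c * t₁) - (s₂ : ℝ) / (c * t₂)| : ℂ)) hα hα4
      (fun t₁ s₁ t₂ s₂ h => by simp only [h, if_true])
  -- Step 2: on the (excluded) diagonal `Δ = 0` the weight `F(0) = 0` kills the term anyway
  have hF00 : F 0 = 0 := hF3 0 (by norm_num)
  have h2 : ∑ q ∈ Ioc 0 N, ∑ t₁ ∈ IT, ∑ s₁ ∈ IS, ∑ t₂ ∈ IT, ∑ s₂ ∈ IS,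
        (if ((q * m : ℕ) : ℤ) ∣ (t₁ : ℤ) * s₂ - (t₂ : ℤ) * s₁ ∧ t₁.Coprime t₂ then
          (if t₁.Coprime m then (J((s₁ : ℤ) | t₁) : ℂ) * α (c * t₁) s₁ else 0) *
            conj (if t₂.Coprime m then (J((s₂ : ℤ) | t₂) : ℂ) * α (c * t₂) s₂ else 0) *
            (J((q : ℤ) | t₁ * t₂) : ℂ) *
            ((F (((((t₁ : ℤ) * s₂ - (t₂ : ℤ) * s₁).natAbs / q : ℕ) : ℝ) / D) : ℂ) *
              (if (t₁ : ℤ) * s₂ - (t₂ : ℤ) * s₁ = 0 then (0 : ℂ) else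
                (g |(s₁ : ℝ) / (c * t₁) - (s₂ : ℝ) / (c * t₂)| : ℂ))) else 0) =
      ∑ q ∈ Ioc 0 N, ∑ t₁ ∈ IT, ∑ s₁ ∈ IS, ∑ t₂ ∈ IT, ∑ s₂ ∈ IS,
        (if ((q * m : ℕ) : ℤ) ∣ (t₁ : ℤ) * s₂ - (t₂ : ℤ) * s₁ ∧ t₁.Coprime t₂ then
          (if t₁.Coprime m then (J((s₁ : ℤ) | t₁) : ℂ) * α (c * t₁) s₁ else 0) *
            conj (if t₂.Coprime m then (J((s₂ : ℤ) | t₂) : ℂ) * α (c * t₂) s₂ else 0) *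
            (J((q : ℤ) | t₁ * t₂) : ℂ) *
            ((F (((((t₁ : ℤ) * s₂ - (t₂ : ℤ) * s₁).natAbs / q : ℕ) : ℝ) / D) : ℂ) *
              (g |(s₁ : ℝ) / (c * t₁) - (s₂ : ℝ) / (c * t₂)| : ℂ)) else 0) := by
    refine sum_congr rfl fun q _ => sum_congr rfl fun t₁ _ => sum_congr rfl fun s₁ _ =>
      sum_congr rfl fun t₂ _ => sum_congr rfl fun s₂ _ => ?_
    by_cases hΔ : (t₁ : ℤ) * s₂ - (t₂ : ℤ) * s₁ = 0
    · simp [hΔ, hF00]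
    · simp only [hΔ, if_false]
  -- Step 3: the range (12.12) and the kernel weight
  have h3 := sum_moduli_eq_sum_range (S := S) (m := m) (L := N) hR hc hD0 F hF3 hF4 g ha hga hgb
    (fun t s : ℕ => if t.Coprime m then (J((s : ℤ) | t) : ℂ) * α (c * t) s else 0)
  -- Step 4: the kernel insertion, fed by Proposition 11.1* over the range
  have hQ₁pos : 0 < Q₁ := by rw [hQ₁]; positivity
  have hQ₂1 : 1 ≤ Q₂ := le_max_left _ _
  have h𝒬pos : ∀ q ∈ 𝒬, 0 < q := fun q hq => (mem_Ioc.mp (mem_filter.mp hq).1).1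
  have h𝒬range : ∀ q ∈ 𝒬, 1 ≤ q ∧ Q₁ < (q : ℝ) ∧ (q : ℝ) ≤ Q₂ := by
    intro q hq
    obtain ⟨hq1, hq2, hq3⟩ := mem_filter.mp hq
    exact ⟨(mem_Ioc.mp hq1).1, hq2, hq3.le.trans (le_max_right _ _)⟩
  have hITpos : ∀ r ∈ IT, 0 < r := fun r hr => lt_of_le_of_lt (Nat.zero_le _) (mem_Ioc.mp hr).1
  have hS0 : (0 : ℝ) ≤ S := Nat.cast_nonneg S
  have hX0 : 0 ≤ (R : ℝ) / c := by positivity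
  have hNn0 : 0 ≤ Nn := sum_nonneg fun _ _ => sum_nonneg fun _ _ => sq_nonneg _
  have hTn0 : 0 ≤ Tn :=
    sum_nonneg fun _ _ => sum_nonneg fun _ _ => mul_nonneg (Nat.cast_nonneg _) (sq_nonneg _)
  have hlogQ₂ : 0 ≤ Real.log Q₂ := Real.log_nonneg hQ₂1
  have hlogR : 0 ≤ Real.log (2 * R) := Real.log_nonneg (by
    have : (1 : ℝ) ≤ R := by exact_mod_cast hR
    linarith)
  -- the coefficient vector after the flip and its pointwise domination by `|α_{ct,s}|`
  have hβle : ∀ t s : ℕ, ‖(if t.Coprime m then (J((s : ℤ) | t) : ℂ) * α (c * t) s else 0)‖ ≤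
      ‖α (c * t) s‖ := by
    intro t s
    split_ifs
    · rw [norm_mul]
      have hJ : ‖(J((s : ℤ) | t) : ℂ)‖ ≤ 1 := by
        rcases jacobiSym.trichotomy (s : ℤ) t with h | h | h <;> simp [h]
      calc ‖(J((s : ℤ) | t) : ℂ)‖ * ‖α (c * t) s‖ ≤ 1 * ‖α (c * t) s‖ :=
          mul_le_mul_of_nonneg_right hJ (norm_nonneg _)
        _ = ‖α (c * t) s‖ := one_mul _
    · rw [norm_zero]; exact norm_nonneg _
  have hβsupp : ∀ t s : ℕ, (if t.Coprime m then (J((s : ℤ) | t) : ℂ) * α (c * t) s else 0) ≠ 0 →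
      Odd t ∧ t.Coprime m := by
    intro t s h
    by_cases htm : t.Coprime m
    · rw [if_pos htm] at h
      have hα0 : α (c * t) s ≠ 0 := fun h0 => h (by rw [h0, mul_zero])
      have hcop := hα (c * t) s hα0
      have h2 : (c * t).Coprime 2 := Nat.Coprime.coprime_dvd_right (dvd_mul_right 2 s) hcop
      have hodd : Odd (c * t) := Nat.coprime_two_right.mp h2
      exact ⟨(Nat.odd_mul.mp hodd).2, htm⟩
    · exact absurd (by rw [if_neg htm]) h
  set B : ℝ := C * (1 + Real.log Q₂) *
      (((R : ℝ) / c * S / Real.sqrt ((m : ℝ) * Q₁) * Real.log (2 * R) +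
        (R : ℝ) / c * S / Real.sqrt Q₁) * Nn +
        ((m : ℝ) * Q₂ * Real.sqrt ((R : ℝ) / c * S) + (R : ℝ) / c * (S : ℝ) ^ (3 / 4 : ℝ) +
            (S : ℝ) * ((R : ℝ) / c) ^ (3 / 4 : ℝ)) * ((R : ℝ) / c * S) ^ ε * Tn) with hB
  have hBound : ∀ u t : ℝ, ∑ q ∈ 𝒬, ‖∑ t₁ ∈ IT, ∑ s₁ ∈ IS, ∑ t₂ ∈ IT, ∑ s₂ ∈ IS,
      (if ((q * m : ℕ) : ℤ) ∣ (t₁ : ℤ) * s₂ - (t₂ : ℤ) * s₁ ∧ t₁.Coprime t₂ then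
        ((if t₁.Coprime m then (J((s₁ : ℤ) | t₁) : ℂ) * α (c * t₁) s₁ else 0) *
              Complex.exp (2 * π * I * t * Real.log t₁) *
            Complex.exp (2 * π * I * u * ((s₁ : ℝ) / (c * t₁) : ℝ))) *
          conj ((if t₂.Coprime m then (J((s₂ : ℤ) | t₂) : ℂ) * α (c * t₂) s₂ else 0) *
              Complex.exp (-(2 * π * I * t * Real.log t₂)) *
            Complex.exp (2 * π * I * u * ((s₂ : ℝ) / (c * t₂) : ℝ))) *
          (J((q : ℤ) | t₁ * t₂) : ℂ) else 0)‖ ≤ B := by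
    intro u t
    have hd := hdy m R S c 𝒬 Q₁ Q₂
      (fun t₁ s₁ : ℕ => (if t₁.Coprime m then (J((s₁ : ℤ) | t₁) : ℂ) * α (c * t₁) s₁ else 0) *
          Complex.exp (2 * π * I * t * Real.log t₁) *
        Complex.exp (2 * π * I * u * ((s₁ : ℝ) / (c * t₁) : ℝ)))
      (fun t₂ s₂ : ℕ => (if t₂.Coprime m then (J((s₂ : ℤ) | t₂) : ℂ) * α (c * t₂) s₂ else 0) *
          Complex.exp (-(2 * π * I * t * Real.log t₂)) *
        Complex.exp (2 * π * I * u * ((s₂ : ℝ) / (c * t₂) : ℝ)))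
      hm hS hc1 hcR hQ₁pos hQ₂1 h𝒬range
      (fun t₁ s₁ h => hβsupp t₁ s₁ (mul_ne_zero_iff.mp (mul_ne_zero_iff.mp h).1).1)
      (fun t₂ s₂ h => hβsupp t₂ s₂ (mul_ne_zero_iff.mp (mul_ne_zero_iff.mp h).1).1)
    refine hd.trans ?_
    -- the twisted vectors have the norms of `β`, dominated by `|α_{ct,s}|`
    have hn1 : ∀ t₁ s₁ : ℕ, ‖(if t₁.Coprime m then (J((s₁ : ℤ) | t₁) : ℂ) * α (c * t₁) s₁ else 0) *
          Complex.exp (2 * π * I * t * Real.log t₁) *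
        Complex.exp (2 * π * I * u * ((s₁ : ℝ) / (c * t₁) : ℝ))‖ ≤ ‖α (c * t₁) s₁‖ := by
      intro t₁ s₁
      rw [norm_mul, norm_mul, show (2 * π * I * t * Real.log t₁ : ℂ) =
        2 * π * I * ((t * Real.log t₁ : ℝ) : ℂ) by push_cast; ring, norm_cexp_two_pi_I,
        show (2 * π * I * u * ((s₁ : ℝ) / (c * t₁) : ℝ) : ℂ) =
          2 * π * I * ((u * ((s₁ : ℝ) / (c * t₁)) : ℝ) : ℂ) by push_cast; ring, norm_cexp_two_pi_I,
        mul_one, mul_one]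
      exact hβle t₁ s₁
    have hn2 : ∀ t₂ s₂ : ℕ, ‖(if t₂.Coprime m then (J((s₂ : ℤ) | t₂) : ℂ) * α (c * t₂) s₂ else 0) *
          Complex.exp (-(2 * π * I * t * Real.log t₂)) *
        Complex.exp (2 * π * I * u * ((s₂ : ℝ) / (c * t₂) : ℝ))‖ ≤ ‖α (c * t₂) s₂‖ := by
      intro t₂ s₂
      rw [norm_mul, norm_mul, show (-(2 * π * I * t * Real.log t₂) : ℂ) =
        2 * π * I * ((-(t * Real.log t₂) : ℝ) : ℂ) by push_cast; ring, norm_cexp_two_pi_I,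
        show (2 * π * I * u * ((s₂ : ℝ) / (c * t₂) : ℝ) : ℂ) =
          2 * π * I * ((u * ((s₂ : ℝ) / (c * t₂)) : ℝ) : ℂ) by push_cast; ring, norm_cexp_two_pi_I,
        mul_one, mul_one]
      exact hβle t₂ s₂
    -- hence the four square-root factors are at most `√Nn, √Nn, √Tn, √Tn`
    have hsqN : ∀ γ : ℕ → ℕ → ℂ, (∀ t₁ s₁ : ℕ, ‖γ t₁ s₁‖ ≤ ‖α (c * t₁) s₁‖) →
        Real.sqrt (∑ r ∈ IT, ∑ s ∈ IS, ‖γ r s‖ ^ 2) ≤ Real.sqrt Nn := by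
      intro γ hγ
      refine Real.sqrt_le_sqrt (sum_le_sum fun r _ => sum_le_sum fun s _ => ?_)
      exact pow_le_pow_left₀ (norm_nonneg _) (hγ r s) 2
    have hsqT : ∀ γ : ℕ → ℕ → ℂ, (∀ t₁ s₁ : ℕ, ‖γ t₁ s₁‖ ≤ ‖α (c * t₁) s₁‖) →
        Real.sqrt (∑ r ∈ IT, ∑ s ∈ IS, (σ 0 r : ℝ) * ‖γ r s‖ ^ 2) ≤ Real.sqrt Tn := by
      intro γ hγ
      refine Real.sqrt_le_sqrt (sum_le_sum fun r _ => sum_le_sum fun s _ => ?_)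
      exact mul_le_mul_of_nonneg_left (pow_le_pow_left₀ (norm_nonneg _) (hγ r s) 2)
        (Nat.cast_nonneg _)
    have hNN : Real.sqrt Nn * Real.sqrt Nn = Nn := Real.mul_self_sqrt hNn0
    have hTT : Real.sqrt Tn * Real.sqrt Tn = Tn := Real.mul_self_sqrt hTn0
    have hP1 : 0 ≤ (R : ℝ) / c * S / Real.sqrt ((m : ℝ) * Q₁) * Real.log (2 * R) +
        (R : ℝ) / c * S / Real.sqrt Q₁ :=
      add_nonneg (mul_nonneg (div_nonneg (mul_nonneg hX0 hS0) (Real.sqrt_nonneg _)) hlogR)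
        (div_nonneg (mul_nonneg hX0 hS0) (Real.sqrt_nonneg _))
    have hm0 : (0 : ℝ) ≤ m := Nat.cast_nonneg m
    have hP2 : 0 ≤ ((m : ℝ) * Q₂ * Real.sqrt ((R : ℝ) / c * S) + (R : ℝ) / c * (S : ℝ) ^ (3 / 4 : ℝ) +
        (S : ℝ) * ((R : ℝ) / c) ^ (3 / 4 : ℝ)) * ((R : ℝ) / c * S) ^ ε :=
      mul_nonneg (add_nonneg (add_nonneg (mul_nonneg (mul_nonneg hm0 (by linarith))
        (Real.sqrt_nonneg _)) (mul_nonneg hX0 (Real.rpow_nonneg hS0 _)))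
        (mul_nonneg hS0 (Real.rpow_nonneg hX0 _))) (Real.rpow_nonneg (mul_nonneg hX0 hS0) _)
    rw [hB]
    refine mul_le_mul_of_nonneg_left (add_le_add ?_ ?_) (mul_nonneg hC.le (by linarith))
    · refine mul_le_mul_of_nonneg_left ?_ hP1
      rw [← hNN]
      exact mul_le_mul (hsqN _ hn1) (hsqN _ hn2) (Real.sqrt_nonneg _) (Real.sqrt_nonneg _)
    · refine mul_le_mul_of_nonneg_left ?_ hP2
      rw [← hTT]
      exact mul_le_mul (hsqT _ hn1) (hsqT _ hn2) (Real.sqrt_nonneg _) (Real.sqrt_nonneg _)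
  have hKI := norm_sum_mul_kernel_le hc hD0 hMc hMi hFM hg00 hĜ 𝒬 IT IS h𝒬pos hITpos
    (fun t s : ℕ => if t.Coprime m then (J((s : ℤ) | t) : ℂ) * α (c * t) s else 0)
    (fun q t₁ s₁ t₂ s₂ : ℕ => ((q * m : ℕ) : ℤ) ∣ (t₁ : ℤ) * s₂ - (t₂ : ℤ) * s₁ ∧ t₁.Coprime t₂) hBound
  -- Step 5: collect
  rw [h1, h2, h3]
  exact hKI

end Literature.NumberTheory.Sieve.FriedlanderIwaniecPrimes
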